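/-
Copyright: the b2b-balaban T⁴-continuum CRUX team, row NE7b leaf lineage `t4-ne7b-formalise-leaf-06` (gen 155). Project licence.
-/
import Mathlib.Analysis.Calculus.MeanValue
import Mathlib.Analysis.Normed.Operator.Bilinear

/-!
# THE NEXT ACTION's FIRST- AND SECOND-ORDER MODULI ON THE HARD STEP's CHART, FROM THIS SCALE's NUMBERS: for `V⁺ = V ∘ σ`,
# `‖DV⁺(w) − DV⁺(w′)‖ ≤ (B·M·L + G·Λ)·‖w − w′‖`, `‖V⁺″(w) − V⁺″(w′)‖ ≤ (ω·L·M² + 2·B·M·Λ)·‖w − w′‖` under the value side's displayed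
# Hessian identity, and the branch's Taylor letter `‖σ w′ − σ w − σ′(w)(w′ − w)‖ ≤ Λ‖w′ − w‖²` — the letters of leaf-04's
# `…HardStepChartRadius` (HSCR: `L`), `…HardStepBranchDeriv` (HSBD: `M`) and `…HardStepBranchDerivModulus` (HSBDM: `Λ`) in, the NEXT
# scale's `‖V⁺″ x − V⁺″ x₀‖ ≤ c⁺` letter out (row NE7b, node U5c; Mathlib only; [folklore])

Cell `pub-balaban`, sub-cell `t4`, spine estimate NE7b (`T4WeightBudget.RelWeightBound`; the cell's OWN estimate — NOT PRINTED
in [Bałaban 1983–89], NOT PROVED).  Crux-route work under `Spine/NE7b/` by leaf-06 (CRUX team (2), FREEZE (0) crux-prover clause).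
NOTHING of Bałaban's is named, asserted, valued or discharged; no `T4Continuum/Support` leaf typed; no `def`; zero `sorry`.  Imports
Mathlib ONLY (the mean value inequality on convex sets, `bilinearComp`) — independent of the `Spine/NE7b` olean frontier: the
CONCLUSIONS of HSCR (`σ` is `L`-Lipschitz on the chart ball into the fibre ball), HSBD (`σ` differentiable with `‖σ′(w)‖ ≤ M`) and
HSBDM (`‖σ′(w) − σ′(w′)‖ ≤ Λ‖w − w′‖`) enter as displayed hypotheses — letters in, letters out; none of the three (nor leaf-03's value
side CVS ∕ CVH ∕ CMR) is imported or restated: no resolvent identity, no augmented-Hessian lemma, no inverse bound here.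

WHY.  The hard-step road iterates «next action `V⁺ = V ∘ σ`» in HESSIAN currency: HSCR's chart AT THE NEXT SCALE asks (i) a bound
and a Lipschitz letter for `DV⁺` (growth ∕ (ℓ2) letters) and (ii) the modulus `‖V⁺″ x − V⁺″ x₀‖ ≤ c⁺` on a ball.  HSBDM closed the
branch side (`σ′` is `Λ`-Lipschitz, `Λ = (N⁻¹ − c)⁻²·M₃·K₁`); what remains is TRANSPORT ALGEBRA plus the mean value inequality:
(§1) a `C^{1,1}` Taylor letter on a convex set from a Lipschitz letter for `fderiv`; (§2) `ℓ ∘ S − ℓ′ ∘ S′` and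
`Q[S·,S·] − Q′[S′·,S′·]` split into Lipschitz-friendly pieces with norm bounds; (§3) `DV` is `B`-Lipschitz on the fibre ball from
`‖V″‖ ≤ B`; (§4) THE FIRST-ORDER END: `fderiv (V ∘ σ) w = DV(σ w) ∘ σ′(w)` by the chain rule, hence
`‖DV⁺(w) − DV⁺(w′)‖ ≤ (B·M·L + G·Λ)‖w − w′‖` and `‖DV⁺(w)‖ ≤ G·M`; (§5) THE SECOND-ORDER END: under the value side's DISPLAYED identity
`W″ w = V″(σ w)[σ′(w)·, σ′(w)·]` (`hW`, the consumer's — see the remark), `‖W″ w − W″ w′‖ ≤ (ω·L·M² + 2·B·M·Λ)‖w − w′‖`, which at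
HSBDM's `Λ = M²·ω·L` reads `ω·L·M²·(1 + 2·B·M)`; (§6) the branch's Taylor letter on the chart ball.  REMARK (prose only, nothing typed):
on the `ker D`-critical branch `hW` IS the Hessian of `V ∘ σ` with `σ ∈ C¹` only — `DV(σ w)` kills `ker D` and `σ′(w) − P ∈ ker D` for
any fixed right inverse `P` of `D`, so `DV⁺(w) = DV(σ w) ∘ P` is `C¹`, and HSBD's propagator letter `V″(σ w)(σ′k)(ker D) = 0` turns
`V″(σ w)[σ′k, P·]` into `V″(σ w)[σ′k, σ′·]`; typing that identity is the value side's (leaf-03), NOT HERE.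

WHAT IS PROVED ([folklore]; Dieudonné, *Foundations of Modern Analysis* (8.6.2) (mean value inequality), (8.12) (composite maps);
nothing cited as a fact; nearest Mathlib items: `Convex.norm_image_sub_le_of_norm_fderiv_le'`, `fderiv_comp`,
`ContinuousLinearMap.bilinearComp` (no norm lemma); Literature `Lorentzian/ExtensionProofs.norm_bilinearComp_le` ∕
`FinalStateConjecture/….firstOrder_norm_bilinearComp_le` are carrier-specific (`E4`), other namespaces — not restated).
* §1 **`norm_sub_sub_fderiv_le_sq_of_lipschitz`** (`s` convex, `σ` differentiable on `s`, `‖fderiv σ x − fderiv σ y‖ ≤ Λ‖x − y‖` on `s`,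
  `0 ≤ Λ` ⟹ `‖σ y − σ x − (fderiv σ x)(y − x)‖ ≤ Λ‖y − x‖²` for `x, y ∈ s`).
* §2 `comp_sub_comp` (`ℓ∘S − ℓ′∘S′ = (ℓ − ℓ′)∘S + ℓ′∘(S − S′)`), **`norm_comp_sub_comp_le`** (`≤ ‖ℓ − ℓ′‖‖S‖ + ‖ℓ′‖‖S − S′‖`),
  `bilinearComp_sub_bilinearComp` (three-term identity), `norm_bilinearComp_le'` (`‖Q[S·,T·]‖ ≤ ‖Q‖‖S‖‖T‖`),
  **`norm_bilinearComp_sub_le`** (`≤ ‖Q − Q′‖‖S‖² + ‖Q′‖‖S − S′‖‖S‖ + ‖Q′‖‖S′‖‖S − S′‖`).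
* §3 **`norm_fderiv_sub_fderiv_le_of_hessian_bound`** (`HasFDerivAt (fderiv V) (V″ x) x` and `‖V″ x‖ ≤ B` on `closedBall δ₀ r` ⟹
  `‖fderiv V x − fderiv V y‖ ≤ B‖x − y‖` there).
* §4 **`fderiv_comp_eq_of_letters`** (chain rule in the road's letters), **`norm_fderiv_comp_le`** (`‖fderiv (V∘σ) w‖ ≤ G·M`),
  **`norm_fderiv_comp_sub_le`** (THE FIRST-ORDER END: `‖fderiv (V∘σ) w − fderiv (V∘σ) w′‖ ≤ (B·M·L + G·Λ)·‖w − w′‖` on `ball w₀ ρ`).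
* §5 **`norm_transportedHessian_sub_le`** (THE SECOND-ORDER END: `hW` + `‖V″ x − V″ y‖ ≤ ω‖x − y‖`, `‖V″ x‖ ≤ B` on the fibre ball +
  the three branch letters ⟹ `‖W″ w − W″ w′‖ ≤ (ω·L·M² + 2·B·M·Λ)·‖w − w′‖`), `norm_transportedHessian_sub_le_of_HSBDM`
  (at `Λ = M²·ω·L`: `≤ ω·L·M²·(1 + 2·B·M)·‖w − w′‖`).
* §6 **`norm_branch_taylor_le_sq`** (`‖σ w′ − σ w − (fderiv σ w)(w′ − w)‖ ≤ Λ‖w′ − w‖²` on `ball w₀ ρ`).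
* §7 toy (`example`): `σ = id` on `ℝ`, `Λ = 0`: the Taylor letter reads `‖w′ − w − (w′ − w)‖ ≤ 0`.

NOT HERE (honest): the identity `hW` (value side, leaf-03's `…ConstrainedValueHessian` ∕ `…ConstrainedValueWindowSecondOrder` ∕
`…PeanoHessianIdentity`); the branch letters themselves (HSCR ∕ HSBD ∕ HSBDM, leaf-04 — displayed); `σ ∈ C²`; the sharp `½` in §1∕§6;
which `V, D, (L, M, Λ, ω, B, G)` are Bałaban's ((A3) ∕ (A1c), NC-NE7b-α UNRULED); anything of Bałaban's.  BY-NAME EFFECT ON THE WALL: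
NONE.  NE7b NOT PRINTED ∕ NOT PROVED; spine PROVED 0∕9; rung (B)+1 on a FINITE torus — NOT infinite volume, NOT the mass gap, NOT Clay.
HONEST DEPENDENCY: continuum YM on T⁴ ⇐ BetaPertH ∧ nine spine estimates (0/9 proved); BetaPertH ⇐ (D1) ∧ (D4) ∧ CAP+tail; G-an2-4
gates asym, D1 and NE2∕3∕4.
-/

set_option autoImplicit false

noncomputable section

namespace Summit.QuantumFields.BalabanUV.T4Continuum.NE7b.HardStepTransportedLetters

open Set Filter Topology Function Metric

variable {E F : Type*} [NormedAddCommGroup E] [NormedSpace ℝ E] [NormedAddCommGroup F] [NormedSpace ℝ F]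

/-! ## §1. A `C^{1,1}` Taylor letter on a convex set from a Lipschitz letter for `fderiv` -/

/-- **TAYLOR LETTER FROM A LIPSCHITZ DERIVATIVE**: on a convex `s`, `σ` differentiable at every point of `s` with
`‖fderiv σ x − fderiv σ y‖ ≤ Λ‖x − y‖` (`0 ≤ Λ`) ⟹ `‖σ y − σ x − (fderiv σ x)(y − x)‖ ≤ Λ·‖y − x‖²` for `x, y ∈ s` (mean value
inequality on the segment `[x, y] ⊆ s ∩ closedBall x ‖y − x‖`; the sharp constant is `Λ∕2`, not needed by the road). [folklore] -/
theorem norm_sub_sub_fderiv_le_sq_of_lipschitz {σ : F → E} {s : Set F} (hs : Convex ℝ s) {Λ : ℝ} (hΛ : 0 ≤ Λ)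
    (hd : ∀ x ∈ s, DifferentiableAt ℝ σ x)
    (hLip : ∀ x ∈ s, ∀ y ∈ s, ‖fderiv ℝ σ x - fderiv ℝ σ y‖ ≤ Λ * ‖x - y‖)
    {x y : F} (hx : x ∈ s) (hy : y ∈ s) :
    ‖σ y - σ x - fderiv ℝ σ x (y - x)‖ ≤ Λ * ‖y - x‖ ^ 2 := by
  have hseg : segment ℝ x y ⊆ s := hs.segment_subset hx hy
  have hseg' : segment ℝ x y ⊆ closedBall x ‖y - x‖ := by
    refine (convex_closedBall x ‖y - x‖).segment_subset (mem_closedBall_self (norm_nonneg _)) ?_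
    rw [mem_closedBall, dist_eq_norm]
  have hbound : ∀ z ∈ segment ℝ x y, ‖fderiv ℝ σ z - fderiv ℝ σ x‖ ≤ Λ * ‖y - x‖ := by
    intro z hz
    refine (hLip z (hseg hz) x hx).trans (mul_le_mul_of_nonneg_left ?_ hΛ)
    have h := hseg' hz
    rwa [mem_closedBall, dist_eq_norm] at h
  have h := (convex_segment x y).norm_image_sub_le_of_norm_fderiv_le' (fun z hz => hd z (hseg hz)) hbound
    (left_mem_segment ℝ x y) (right_mem_segment ℝ x y)
  calc ‖σ y - σ x - fderiv ℝ σ x (y - x)‖ ≤ Λ * ‖y - x‖ * ‖y - x‖ := h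
    _ = Λ * ‖y - x‖ ^ 2 := by ring

/-! ## §2. Transport algebra: `ℓ ∘ S − ℓ′ ∘ S′` and `Q[S·,S·] − Q′[S′·,S′·]` -/

section Algebra

variable {G : Type*} [NormedAddCommGroup G] [NormedSpace ℝ G]

/-- `ℓ ∘ S − ℓ′ ∘ S′ = (ℓ − ℓ′) ∘ S + ℓ′ ∘ (S − S′)`. [folklore] -/
theorem comp_sub_comp (ℓ ℓ' : E →L[ℝ] G) (S S' : F →L[ℝ] E) :
    ℓ.comp S - ℓ'.comp S' = (ℓ - ℓ').comp S + ℓ'.comp (S - S') := by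
  rw [ContinuousLinearMap.sub_comp, ContinuousLinearMap.comp_sub]
  abel

/-- **`‖ℓ ∘ S − ℓ′ ∘ S′‖ ≤ ‖ℓ − ℓ′‖·‖S‖ + ‖ℓ′‖·‖S − S′‖`**. [folklore] -/
theorem norm_comp_sub_comp_le (ℓ ℓ' : E →L[ℝ] G) (S S' : F →L[ℝ] E) :
    ‖ℓ.comp S - ℓ'.comp S'‖ ≤ ‖ℓ - ℓ'‖ * ‖S‖ + ‖ℓ'‖ * ‖S - S'‖ := by
  rw [comp_sub_comp]
  exact (norm_add_le ((ℓ - ℓ').comp S) (ℓ'.comp (S - S'))).trans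
    (add_le_add (ContinuousLinearMap.opNorm_comp_le _ _) (ContinuousLinearMap.opNorm_comp_le _ _))

/-- Three-term identity: `Q[S·,S·] − Q′[S′·,S′·] = (Q − Q′)[S·,S·] + Q′[(S − S′)·, S·] + Q′[S′·, (S − S′)·]`. [folklore] -/
theorem bilinearComp_sub_bilinearComp (Q Q' : E →L[ℝ] E →L[ℝ] ℝ) (S S' : F →L[ℝ] E) :
    Q.bilinearComp S S - Q'.bilinearComp S' S' =
      (Q - Q').bilinearComp S S + Q'.bilinearComp (S - S') S + Q'.bilinearComp S' (S - S') := by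
  ext x y
  simp only [sub_apply, add_apply, ContinuousLinearMap.bilinearComp_apply, map_sub]
  ring

/-- `‖Q[S·,T·]‖ ≤ ‖Q‖·‖S‖·‖T‖`. [folklore] -/
theorem norm_bilinearComp_le' (Q : E →L[ℝ] E →L[ℝ] ℝ) (S T : F →L[ℝ] E) :
    ‖Q.bilinearComp S T‖ ≤ ‖Q‖ * ‖S‖ * ‖T‖ := by
  refine ContinuousLinearMap.opNorm_le_bound _ (by positivity) fun x => ?_
  refine ContinuousLinearMap.opNorm_le_bound _ (by positivity) fun y => ?_
  rw [ContinuousLinearMap.bilinearComp_apply]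
  calc ‖Q (S x) (T y)‖ ≤ ‖Q (S x)‖ * ‖T y‖ := ContinuousLinearMap.le_opNorm _ _
    _ ≤ ‖Q‖ * ‖S x‖ * (‖T‖ * ‖y‖) :=
        mul_le_mul (ContinuousLinearMap.le_opNorm _ _) (ContinuousLinearMap.le_opNorm _ _) (norm_nonneg _)
          (mul_nonneg (norm_nonneg Q) (norm_nonneg (S x)))
    _ ≤ ‖Q‖ * (‖S‖ * ‖x‖) * (‖T‖ * ‖y‖) := by
        gcongr
        exact ContinuousLinearMap.le_opNorm _ _
    _ = ‖Q‖ * ‖S‖ * ‖T‖ * ‖x‖ * ‖y‖ := by ring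

/-- **`‖Q[S·,S·] − Q′[S′·,S′·]‖ ≤ ‖Q − Q′‖‖S‖² + ‖Q′‖‖S − S′‖‖S‖ + ‖Q′‖‖S′‖‖S − S′‖`**. [folklore] -/
theorem norm_bilinearComp_sub_le (Q Q' : E →L[ℝ] E →L[ℝ] ℝ) (S S' : F →L[ℝ] E) :
    ‖Q.bilinearComp S S - Q'.bilinearComp S' S'‖ ≤
      ‖Q - Q'‖ * ‖S‖ * ‖S‖ + ‖Q'‖ * ‖S - S'‖ * ‖S‖ + ‖Q'‖ * ‖S'‖ * ‖S - S'‖ := by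
  rw [bilinearComp_sub_bilinearComp]
  calc ‖(Q - Q').bilinearComp S S + Q'.bilinearComp (S - S') S + Q'.bilinearComp S' (S - S')‖
      ≤ ‖(Q - Q').bilinearComp S S + Q'.bilinearComp (S - S') S‖ + ‖Q'.bilinearComp S' (S - S')‖ :=
        norm_add_le ((Q - Q').bilinearComp S S + Q'.bilinearComp (S - S') S) (Q'.bilinearComp S' (S - S'))
    _ ≤ ‖(Q - Q').bilinearComp S S‖ + ‖Q'.bilinearComp (S - S') S‖ + ‖Q'.bilinearComp S' (S - S')‖ := by
        gcongr
        exact norm_add_le ((Q - Q').bilinearComp S S) (Q'.bilinearComp (S - S') S)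
    _ ≤ ‖Q - Q'‖ * ‖S‖ * ‖S‖ + ‖Q'‖ * ‖S - S'‖ * ‖S‖ + ‖Q'‖ * ‖S'‖ * ‖S - S'‖ := by
        gcongr
        · exact norm_bilinearComp_le' _ _ _
        · exact norm_bilinearComp_le' _ _ _
        · exact norm_bilinearComp_le' _ _ _

end Algebra

/-! ## §3. `DV` is `B`-Lipschitz on the fibre ball from `‖V″‖ ≤ B` -/

/-- **`‖DV x − DV y‖ ≤ B‖x − y‖` ON THE FIBRE BALL** from `HasFDerivAt (fderiv V) (V″ x) x` and `‖V″ x‖ ≤ B` at every point of the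
(convex) closed ball (mean value inequality for `fderiv V`). [folklore] -/
theorem norm_fderiv_sub_fderiv_le_of_hessian_bound {V : E → ℝ} {V'' : E → E →L[ℝ] E →L[ℝ] ℝ} {δ₀ : E} {r B : ℝ}
    (hV : ∀ x ∈ closedBall δ₀ r, HasFDerivAt (fderiv ℝ V) (V'' x) x) (hVB : ∀ x ∈ closedBall δ₀ r, ‖V'' x‖ ≤ B)
    {x y : E} (hx : x ∈ closedBall δ₀ r) (hy : y ∈ closedBall δ₀ r) :
    ‖fderiv ℝ V x - fderiv ℝ V y‖ ≤ B * ‖x - y‖ :=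
  (convex_closedBall δ₀ r).norm_image_sub_le_of_norm_hasFDerivWithin_le
    (fun z hz => (hV z hz).hasFDerivWithinAt) hVB hy hx

/-! ## §4. THE FIRST-ORDER END: `DV⁺ = DV(σ ·) ∘ σ′`, bound `G·M`, Lipschitz constant `B·M·L + G·Λ` -/

section FirstOrder

variable {V : E → ℝ} {V'' : E → E →L[ℝ] E →L[ℝ] ℝ} {σ : F → E} {δ₀ : E} {w₀ : F} {r ρ L M Λ B G : ℝ}

/-- **CHAIN RULE IN THE ROAD's LETTERS**: `V` differentiable on the fibre ball, `σ` differentiable on the chart ball into it ⟹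
`fderiv (V ∘ σ) w = (fderiv V (σ w)) ∘ (fderiv σ w)`. [folklore] -/
theorem fderiv_comp_eq_of_letters (hVd : ∀ x ∈ closedBall δ₀ r, DifferentiableAt ℝ V x)
    (hσr : ∀ w ∈ ball w₀ ρ, σ w ∈ closedBall δ₀ r) (hσd : ∀ w ∈ ball w₀ ρ, DifferentiableAt ℝ σ w)
    {w : F} (hw : w ∈ ball w₀ ρ) :
    fderiv ℝ (V ∘ σ) w = (fderiv ℝ V (σ w)).comp (fderiv ℝ σ w) :=
  fderiv_comp w (hVd _ (hσr w hw)) (hσd w hw)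

/-- **`‖DV⁺(w)‖ ≤ G·M`**: `‖DV‖ ≤ G` on the fibre ball and HSBD's `‖σ′‖ ≤ M`. [folklore] -/
theorem norm_fderiv_comp_le (hVd : ∀ x ∈ closedBall δ₀ r, DifferentiableAt ℝ V x)
    (hVG : ∀ x ∈ closedBall δ₀ r, ‖fderiv ℝ V x‖ ≤ G)
    (hσr : ∀ w ∈ ball w₀ ρ, σ w ∈ closedBall δ₀ r) (hσd : ∀ w ∈ ball w₀ ρ, DifferentiableAt ℝ σ w)
    (hσM : ∀ w ∈ ball w₀ ρ, ‖fderiv ℝ σ w‖ ≤ M) {w : F} (hw : w ∈ ball w₀ ρ) :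
    ‖fderiv ℝ (V ∘ σ) w‖ ≤ G * M := by
  rw [fderiv_comp_eq_of_letters hVd hσr hσd hw]
  have hG0 : 0 ≤ G := (norm_nonneg (fderiv ℝ V (σ w))).trans (hVG _ (hσr w hw))
  exact (ContinuousLinearMap.opNorm_comp_le _ _).trans (mul_le_mul (hVG _ (hσr w hw)) (hσM w hw) (norm_nonneg _) hG0)

/-- **THE FIRST-ORDER END — `DV⁺` IS LIPSCHITZ WITH CONSTANT `B·M·L + G·Λ`**: `V` twice differentiable on the fibre ball with
`‖V″‖ ≤ B`, `‖DV‖ ≤ G`; the branch letters (HSCR: `σ(ball) ⊆ closedBall δ₀ r`, `‖σ w − σ w′‖ ≤ L‖w − w′‖`; HSBD: differentiable,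
`‖σ′‖ ≤ M`; HSBDM: `‖σ′(w) − σ′(w′)‖ ≤ Λ‖w − w′‖`) ⟹ `‖DV⁺(w) − DV⁺(w′)‖ ≤ (B·M·L + G·Λ)·‖w − w′‖` on `ball w₀ ρ`. [folklore] -/
theorem norm_fderiv_comp_sub_le (hB : 0 ≤ B)
    (hVd : ∀ x ∈ closedBall δ₀ r, DifferentiableAt ℝ V x)
    (hV : ∀ x ∈ closedBall δ₀ r, HasFDerivAt (fderiv ℝ V) (V'' x) x) (hVB : ∀ x ∈ closedBall δ₀ r, ‖V'' x‖ ≤ B)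
    (hVG : ∀ x ∈ closedBall δ₀ r, ‖fderiv ℝ V x‖ ≤ G)
    (hσr : ∀ w ∈ ball w₀ ρ, σ w ∈ closedBall δ₀ r)
    (hσL : ∀ w ∈ ball w₀ ρ, ∀ w' ∈ ball w₀ ρ, ‖σ w - σ w'‖ ≤ L * ‖w - w'‖)
    (hσd : ∀ w ∈ ball w₀ ρ, DifferentiableAt ℝ σ w) (hσM : ∀ w ∈ ball w₀ ρ, ‖fderiv ℝ σ w‖ ≤ M)
    (hσΛ : ∀ w ∈ ball w₀ ρ, ∀ w' ∈ ball w₀ ρ, ‖fderiv ℝ σ w - fderiv ℝ σ w'‖ ≤ Λ * ‖w - w'‖)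
    {w w' : F} (hw : w ∈ ball w₀ ρ) (hw' : w' ∈ ball w₀ ρ) :
    ‖fderiv ℝ (V ∘ σ) w - fderiv ℝ (V ∘ σ) w'‖ ≤ (B * M * L + G * Λ) * ‖w - w'‖ := by
  rw [fderiv_comp_eq_of_letters hVd hσr hσd hw, fderiv_comp_eq_of_letters hVd hσr hσd hw']
  have hG0 : 0 ≤ G := (norm_nonneg (fderiv ℝ V (σ w))).trans (hVG _ (hσr w hw))
  have h1 : ‖fderiv ℝ V (σ w) - fderiv ℝ V (σ w')‖ ≤ B * (L * ‖w - w'‖) :=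
    (norm_fderiv_sub_fderiv_le_of_hessian_bound hV hVB (hσr w hw) (hσr w' hw')).trans
      (mul_le_mul_of_nonneg_left (hσL w hw w' hw') hB)
  have hc0 : 0 ≤ B * (L * ‖w - w'‖) := (norm_nonneg (fderiv ℝ V (σ w) - fderiv ℝ V (σ w'))).trans h1
  calc ‖(fderiv ℝ V (σ w)).comp (fderiv ℝ σ w) - (fderiv ℝ V (σ w')).comp (fderiv ℝ σ w')‖
      ≤ ‖fderiv ℝ V (σ w) - fderiv ℝ V (σ w')‖ * ‖fderiv ℝ σ w‖ +
          ‖fderiv ℝ V (σ w')‖ * ‖fderiv ℝ σ w - fderiv ℝ σ w'‖ := norm_comp_sub_comp_le _ _ _ _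
    _ ≤ B * (L * ‖w - w'‖) * M + G * (Λ * ‖w - w'‖) :=
        add_le_add (mul_le_mul h1 (hσM w hw) (norm_nonneg _) hc0)
          (mul_le_mul (hVG _ (hσr w' hw')) (hσΛ w hw w' hw') (norm_nonneg _) hG0)
    _ = (B * M * L + G * Λ) * ‖w - w'‖ := by ring

end FirstOrder

/-! ## §5. THE SECOND-ORDER END: the transported Hessian form is Lipschitz with constant `ω·L·M² + 2·B·M·Λ` -/

section SecondOrder

variable {V'' : E → E →L[ℝ] E →L[ℝ] ℝ} {W'' : F → F →L[ℝ] F →L[ℝ] ℝ} {σ : F → E} {δ₀ : E} {w₀ : F}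
  {r ρ L M Λ ω B : ℝ}

/-- **THE SECOND-ORDER END — THE NEXT SCALE's HESSIAN MODULUS FROM THIS SCALE's NUMBERS.**  Letters: the modulus
`‖V″ x − V″ y‖ ≤ ω‖x − y‖` and the bound `‖V″ x‖ ≤ B` on `closedBall δ₀ r`; the branch letters on `ball w₀ ρ` (HSCR: values in the
fibre ball, `‖σ w − σ w′‖ ≤ L‖w − w′‖`; HSBD: `‖fderiv σ w‖ ≤ M`; HSBDM: `‖fderiv σ w − fderiv σ w′‖ ≤ Λ‖w − w′‖`); the value side's
DISPLAYED identity `hW : W″ w = V″(σ w)[σ′(w)·, σ′(w)·]` ⟹ `‖W″ w − W″ w′‖ ≤ (ω·L·M² + 2·B·M·Λ)·‖w − w′‖`. [folklore] -/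
theorem norm_transportedHessian_sub_le (hM : 0 ≤ M) (hω : 0 ≤ ω)
    (hVω : ∀ x ∈ closedBall δ₀ r, ∀ y ∈ closedBall δ₀ r, ‖V'' x - V'' y‖ ≤ ω * ‖x - y‖)
    (hVB : ∀ x ∈ closedBall δ₀ r, ‖V'' x‖ ≤ B)
    (hσr : ∀ w ∈ ball w₀ ρ, σ w ∈ closedBall δ₀ r)
    (hσL : ∀ w ∈ ball w₀ ρ, ∀ w' ∈ ball w₀ ρ, ‖σ w - σ w'‖ ≤ L * ‖w - w'‖)
    (hσM : ∀ w ∈ ball w₀ ρ, ‖fderiv ℝ σ w‖ ≤ M)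
    (hσΛ : ∀ w ∈ ball w₀ ρ, ∀ w' ∈ ball w₀ ρ, ‖fderiv ℝ σ w - fderiv ℝ σ w'‖ ≤ Λ * ‖w - w'‖)
    (hW : ∀ w ∈ ball w₀ ρ, W'' w = (V'' (σ w)).bilinearComp (fderiv ℝ σ w) (fderiv ℝ σ w))
    {w w' : F} (hw : w ∈ ball w₀ ρ) (hw' : w' ∈ ball w₀ ρ) :
    ‖W'' w - W'' w'‖ ≤ (ω * L * M ^ 2 + 2 * B * M * Λ) * ‖w - w'‖ := by
  rw [hW w hw, hW w' hw']
  have hQ : ‖V'' (σ w) - V'' (σ w')‖ ≤ ω * (L * ‖w - w'‖) :=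
    (hVω _ (hσr w hw) _ (hσr w' hw')).trans (mul_le_mul_of_nonneg_left (hσL w hw w' hw') hω)
  have hQ' : ‖V'' (σ w')‖ ≤ B := hVB _ (hσr w' hw')
  have hB0 : 0 ≤ B := (norm_nonneg (V'' (σ w'))).trans hQ'
  have hQ0 : 0 ≤ ω * (L * ‖w - w'‖) := (norm_nonneg (V'' (σ w) - V'' (σ w'))).trans hQ
  have hΛ0 : 0 ≤ Λ * ‖w - w'‖ := (norm_nonneg (fderiv ℝ σ w - fderiv ℝ σ w')).trans (hσΛ w hw w' hw')
  calc ‖(V'' (σ w)).bilinearComp (fderiv ℝ σ w) (fderiv ℝ σ w) -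
        (V'' (σ w')).bilinearComp (fderiv ℝ σ w') (fderiv ℝ σ w')‖
      ≤ ‖V'' (σ w) - V'' (σ w')‖ * ‖fderiv ℝ σ w‖ * ‖fderiv ℝ σ w‖ +
          ‖V'' (σ w')‖ * ‖fderiv ℝ σ w - fderiv ℝ σ w'‖ * ‖fderiv ℝ σ w‖ +
          ‖V'' (σ w')‖ * ‖fderiv ℝ σ w'‖ * ‖fderiv ℝ σ w - fderiv ℝ σ w'‖ :=
        norm_bilinearComp_sub_le _ _ _ _
    _ ≤ ω * (L * ‖w - w'‖) * M * M + B * (Λ * ‖w - w'‖) * M + B * M * (Λ * ‖w - w'‖) := by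
        gcongr
        · exact hσM w hw
        · exact hσM w hw
        · exact hσΛ w hw w' hw'
        · exact hσM w hw
        · exact hσM w' hw'
        · exact hσΛ w hw w' hw'
    _ = (ω * L * M ^ 2 + 2 * B * M * Λ) * ‖w - w'‖ := by ring

/-- **AT HSBDM's CONSTANT `Λ = M²·ω·L`** the modulus reads `ω·L·M²·(1 + 2·B·M)·‖w − w′‖` — the next scale's `c⁺`-letter with
`c⁺ := ω·L·M²·(1 + 2·B·M)·(radius)`, every number this scale's. [folklore] -/
theorem norm_transportedHessian_sub_le_of_HSBDM (hM : 0 ≤ M) (hω : 0 ≤ ω)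
    (hVω : ∀ x ∈ closedBall δ₀ r, ∀ y ∈ closedBall δ₀ r, ‖V'' x - V'' y‖ ≤ ω * ‖x - y‖)
    (hVB : ∀ x ∈ closedBall δ₀ r, ‖V'' x‖ ≤ B)
    (hσr : ∀ w ∈ ball w₀ ρ, σ w ∈ closedBall δ₀ r)
    (hσL : ∀ w ∈ ball w₀ ρ, ∀ w' ∈ ball w₀ ρ, ‖σ w - σ w'‖ ≤ L * ‖w - w'‖)
    (hσM : ∀ w ∈ ball w₀ ρ, ‖fderiv ℝ σ w‖ ≤ M)
    (hσΛ : ∀ w ∈ ball w₀ ρ, ∀ w' ∈ ball w₀ ρ, ‖fderiv ℝ σ w - fderiv ℝ σ w'‖ ≤ M ^ 2 * ω * L * ‖w - w'‖)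
    (hW : ∀ w ∈ ball w₀ ρ, W'' w = (V'' (σ w)).bilinearComp (fderiv ℝ σ w) (fderiv ℝ σ w))
    {w w' : F} (hw : w ∈ ball w₀ ρ) (hw' : w' ∈ ball w₀ ρ) :
    ‖W'' w - W'' w'‖ ≤ ω * L * M ^ 2 * (1 + 2 * B * M) * ‖w - w'‖ := by
  have h := norm_transportedHessian_sub_le hM hω hVω hVB hσr hσL hσM hσΛ hW hw hw'
  calc ‖W'' w - W'' w'‖ ≤ (ω * L * M ^ 2 + 2 * B * M * (M ^ 2 * ω * L)) * ‖w - w'‖ := h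
    _ = ω * L * M ^ 2 * (1 + 2 * B * M) * ‖w - w'‖ := by ring

end SecondOrder

/-! ## §6. The branch's Taylor letter on the chart ball -/

/-- **`‖σ w′ − σ w − σ′(w)(w′ − w)‖ ≤ Λ·‖w′ − w‖²`** on `ball w₀ ρ` from HSBD's differentiability and HSBDM's `Λ`-Lipschitz letter
for `σ′` (§1 on the convex ball). [folklore] -/
theorem norm_branch_taylor_le_sq {σ : F → E} {w₀ : F} {ρ Λ : ℝ} (hΛ : 0 ≤ Λ)
    (hσd : ∀ w ∈ ball w₀ ρ, DifferentiableAt ℝ σ w)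
    (hσΛ : ∀ w ∈ ball w₀ ρ, ∀ w' ∈ ball w₀ ρ, ‖fderiv ℝ σ w - fderiv ℝ σ w'‖ ≤ Λ * ‖w - w'‖)
    {w w' : F} (hw : w ∈ ball w₀ ρ) (hw' : w' ∈ ball w₀ ρ) :
    ‖σ w' - σ w - fderiv ℝ σ w (w' - w)‖ ≤ Λ * ‖w' - w‖ ^ 2 :=
  norm_sub_sub_fderiv_le_sq_of_lipschitz (convex_ball w₀ ρ) hΛ hσd hσΛ hw hw'

/-! ## §7. Toy -/

/-- Toy: `σ = id` on `ℝ` (the unit ball around `0`), `Λ = 0`: the Taylor letter reads `‖w′ − w − (w′ − w)‖ ≤ 0·‖w′ − w‖²`. [folklore] -/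
example {w w' : ℝ} (hw : w ∈ ball (0 : ℝ) 1) (hw' : w' ∈ ball (0 : ℝ) 1) :
    ‖id w' - id w - fderiv ℝ id w (w' - w)‖ ≤ 0 * ‖w' - w‖ ^ 2 :=
  norm_branch_taylor_le_sq le_rfl (fun _ _ => differentiableAt_id) (fun x _ y _ => by simp [fderiv_id]) hw hw'

end Summit.QuantumFields.BalabanUV.T4Continuum.NE7b.HardStepTransportedLetters

end
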